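import Summits.Ventures.PercRepro.RankLevelSetRuleQConvTwentyThree
/-!
# PercRepro — THE DEPTH-23 CONVERGENT: THE TWO PRODUCTS OF THE sub-solution defect (p4, gen 25; C-044; paper §13.7):
`D(m+1)·(2(m+1)·N + q·D)` normalised in `(q, m)`, the 234-term factor on the left.  No `sorry`; axioms standard.
-/

namespace PercRepro


set_option maxHeartbeats 6400000 in
set_option maxRecDepth 16384 in
/-- The first product identity. -/
lemma cfTwentyThree_step_prodP (q m : ℚ) :
    cfTwentyThreeD q (m + 1) * (2 * (m + 1) * cfTwentyThreeN q m + q * cfTwentyThreeD q m) = cfTwentyThreeStepP q m := by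
  unfold cfTwentyThreeN cfTwentyThreeD cfTwentyThreeStepP; ring



set_option maxHeartbeats 6400000 in
set_option maxRecDepth 16384 in
/-- The second product identity. -/
lemma cfTwentyThree_step_prodQ (q m : ℚ) :
    cfTwentyThreeD q m * ((q + m + 1) * cfTwentyThreeN q (m + 1)) = cfTwentyThreeStepQ q m := by
  unfold cfTwentyThreeN cfTwentyThreeD cfTwentyThreeStepQ; ring


end PercRepro
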